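import Summits.MatrixMultiplication.OmegaCensus.DicyclicN1Cosets
import Summits.MatrixMultiplication.OmegaCensus.DicyclicLawReduction
import Summits.MatrixMultiplication.OmegaCensus.DicyclicExactTiling
import Summits.MatrixMultiplication.OmegaCensus.DihedralLikeVertexCounting
import Summits.MatrixMultiplication.OmegaCensus.DihedralLawModOneShapeB
import HarnessLib

/-!
# Class N1 (`(1,1),(2,2),(u₀,u₁)`, `u₀ ≠ u₁`) of the dicyclic-law triples is dead when `A/⟨c₀⟩` is a `2`-group
# mapping onto `𝔽₂³`

ω-census `pub-omega`, family (b3), seat pub-omega-group gen 12.  Framing: lottery ticket; floor = certified bounds/negative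
ranges.  VALUE: kernel theorem about the group-theoretic method (TPP capacity of dihedral-like groups); NOT progress on ω.

Dicyclic type `G(A, c₀)` (`c₀ ≠ 0`), `π : A →+ B` onto with kernel `{0, c₀}`, `B` a `2`-group, three homomorphisms
`A →+ ZMod 2` killing `c₀` and jointly onto `𝔽₂³`.  A TPP triple with `|S₀| = |S₁| = 1`, `|T₀| = |T₁| = 2`, `|U₀| ≠ |U₁|`
attaining `3|S||T||U| + 16 = 8|A|` has `|U₀| = |U₁| ± 2` (vertex counting and `8 ∣ |A|`); after a `τ0`-translation of `U`
the four vertices `(i,j,0)` are exact.  `n1_vertex_data` extracts from such a triple (and from its `T·τ0`-translate) the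
additive data of `DicyclicN1Dichotomy.lean` / `DicyclicN1Cosets.lean`: the tilings (T1)/(T2), the periodicity of the pair
sets `U_l ⊔ (U_l + e_j)`, their freeness, and the packing inclusion (F) (from the `c₀`-shifted disjointness relations
`disjoint_sumset₁_shift'`, `disjoint_sumset₂_shift'`).  `n1_four_cosets` then covers `A` by the four cosets
`{0, z, c₀, z + c₀} + ⟨g⟩`, contradicting `psi_not_onto_of_four_cosets`.

**`no_n1_dicyclic_law`**: no such triple attains the dicyclic law.  With P1 (`no_two_domino_dicyclic_law_of_rank_three`),
N2 (`no_n2_dicyclic_law`) and N3 (`no_n3_dicyclic_law`) four of the five shape classes of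
`pub-omega-group-g11/FAMILY-B-ADDENDUM-g11.md` §2 are kernel-dead for these quotients; the balanced class B remains.
-/

namespace Summit.MatrixMultiplication.OmegaCensus

open Literature.Combinatorics.Additive Finset

section Tools

variable {A : Type} [AddCommGroup A] [DecidableEq A]

/-- A box with a singleton and a pair factor is the union of two translates. [folklore] -/
theorem sumset_single_pair (s t e : A) (W : Finset A) :
    ((({s} : Finset A) ×ˢ ({t, t + e} : Finset A) ×ˢ W).image fun p : A × A × A => p.1 + p.2.1 + p.2.2) =
      W.image (· + (s + t)) ∪ W.image (· + (s + t + e)) := by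
  ext x
  rw [mem_sumset₃, mem_union, mem_image, mem_image]
  constructor
  · rintro ⟨a, ha, b, hb, c, hc, rfl⟩
    rw [mem_singleton] at ha
    subst ha
    rcases mem_insert.1 hb with rfl | hb
    · exact Or.inl ⟨c, hc, by abel⟩
    · rw [mem_singleton] at hb; subst hb
      exact Or.inr ⟨c, hc, by abel⟩
  · rintro (⟨c, hc, rfl⟩ | ⟨c, hc, rfl⟩)
    · exact ⟨s, mem_singleton_self _, t, mem_insert_self _ _, c, hc, by abel⟩
    · exact ⟨s, mem_singleton_self _, t + e, mem_insert_of_mem (mem_singleton_self _), c, hc, by abel⟩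

/-- Two translates whose union has double size are disjoint. [folklore] -/
theorem disjoint_translates_of_card {X : Finset A} {a b : A}
    (h : (X.image (· + a) ∪ X.image (· + b)).card = X.card + X.card) :
    Disjoint (X.image (· + a)) (X.image (· + b)) := by
  rw [disjoint_iff_inter_eq_empty, ← card_eq_zero]
  have := card_union_add_card_inter (X.image (· + a)) (X.image (· + b))
  rw [h, card_image_add, card_image_add] at this
  omega

/-- If a translate of `X` is `c`-periodic then so is `X`. [folklore] -/
theorem periodic_of_translate_periodic {X : Finset A} {α c : A}
    (h : (X.image (· + α)).image (· + c) = X.image (· + α)) : X.image (· + c) = X := by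
  symm
  apply eq_of_subset_of_card_le _ (by rw [card_image_add])
  intro x hx
  have : x + α ∈ (X.image (· + α)).image (· + c) := by rw [h]; exact mem_image_of_mem _ hx
  obtain ⟨z, hz, hzx⟩ := mem_image.1 this
  obtain ⟨w, hw, rfl⟩ := mem_image.1 hz
  exact mem_image.2 ⟨w, hw, add_right_cancel ((add_right_comm w c α).trans hzx)⟩

end Tools

section N1

variable {A : Type} [AddCommGroup A] [DecidableEq A] [Fintype A] {G : Type} [Group G] [DecidableEq G]
  {ρ τ : A → G} {c₀ : A} {B : Type} [AddCommGroup B] [DecidableEq B] [Fintype B]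

/-- **Vertex data of an N1 triple with `4|U₀| + 2|U₁| = |A|`** (vertex `000` exact).  For a TPP triple with
`S₀ = {s₀}`, `S₁ = {s₁}`, `T₀ = {t₀, t₀ + e₀}`, `T₁ = {t₁, t₁ + e₁}` (`e₀, e₁ ≠ 0`): the parts `U₀, U₁` are `e₀`- and
`e₁`-free; the boxes `S₁+T₀+U₀`, `S₀+T₀+U₁`, `S₀+T₁+U₀` (written as unions of two translates) are pairwise disjoint; the
pair sets `U₀ ⊔ U₀+e₀`, `U₁ ⊔ U₁+e₀`, `U₀ ⊔ U₀+e₁` are `c₀`-periodic; and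
`U₁ + y ⊔ U₁ + y + e₁ ⊆ U₀ ⊔ U₀ + e₁` with `y = (s₁+t₀) + (s₀+t₀) − (s₀+t₁) − (s₀+t₁) + e₀ − e₁ + c₀`. [folklore] -/
theorem n1_vertex_data
    (hρρ : ∀ a b, ρ a * ρ b = ρ (a + b)) (hρτ : ∀ a b, ρ a * τ b = τ (b - a))
    (hτρ : ∀ a b, τ a * ρ b = τ (a + b)) (hττ : ∀ a b, τ a * τ b = ρ (c₀ + b - a))
    (hρ : Function.Injective ρ) (hτ : Function.Injective τ) (hne : ∀ a b, ρ a ≠ τ b)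
    {S T U : Finset G} (h : TripleProductProperty S T U) {s₀ s₁ t₀ t₁ e₀ e₁ : A}
    (hS₀ : (univ.filter fun a : A => ρ a ∈ S) = {s₀}) (hS₁ : (univ.filter fun a : A => τ a ∈ S) = {s₁})
    (hT₀ : (univ.filter fun a : A => ρ a ∈ T) = {t₀, t₀ + e₀})
    (hT₁ : (univ.filter fun a : A => τ a ∈ T) = {t₁, t₁ + e₁}) (he₀ : e₀ ≠ 0) (he₁ : e₁ ≠ 0)
    (hex : 4 * (univ.filter fun a : A => ρ a ∈ U).card + 2 * (univ.filter fun a : A => τ a ∈ U).card =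
      Fintype.card A) :
    let U₀ := (univ.filter fun a : A => ρ a ∈ U)
    let U₁ := (univ.filter fun a : A => τ a ∈ U)
    (Disjoint U₀ (U₀.image (· + e₀)) ∧ Disjoint U₀ (U₀.image (· + e₁)) ∧
      Disjoint U₁ (U₁.image (· + e₀)) ∧ Disjoint U₁ (U₁.image (· + e₁))) ∧
    (Disjoint (U₀.image (· + (s₁ + t₀)) ∪ U₀.image (· + (s₁ + t₀ + e₀)))
        (U₁.image (· + (s₀ + t₀)) ∪ U₁.image (· + (s₀ + t₀ + e₀))) ∧
      Disjoint (U₀.image (· + (s₁ + t₀)) ∪ U₀.image (· + (s₁ + t₀ + e₀)))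
        (U₀.image (· + (s₀ + t₁)) ∪ U₀.image (· + (s₀ + t₁ + e₁))) ∧
      Disjoint (U₁.image (· + (s₀ + t₀)) ∪ U₁.image (· + (s₀ + t₀ + e₀)))
        (U₀.image (· + (s₀ + t₁)) ∪ U₀.image (· + (s₀ + t₁ + e₁)))) ∧
    ((U₀ ∪ U₀.image (· + e₀)).image (· + c₀) = U₀ ∪ U₀.image (· + e₀) ∧
      (U₁ ∪ U₁.image (· + e₀)).image (· + c₀) = U₁ ∪ U₁.image (· + e₀) ∧
      (U₀ ∪ U₀.image (· + e₁)).image (· + c₀) = U₀ ∪ U₀.image (· + e₁)) ∧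
    U₁.image (· + (s₁ + t₀ + (s₀ + t₀) - (s₀ + t₁) - (s₀ + t₁) + e₀ - e₁ + c₀)) ∪
        U₁.image (· + (s₁ + t₀ + (s₀ + t₀) - (s₀ + t₁) - (s₀ + t₁) + e₀ - e₁ + c₀ + e₁)) ⊆
      U₀ ∪ U₀.image (· + e₁) := by
  intro U₀ U₁
  set S₀ : Finset A := univ.filter fun a => ρ a ∈ S with hS₀d
  set S₁ : Finset A := univ.filter fun a => τ a ∈ S with hS₁d
  set T₀ : Finset A := univ.filter fun a => ρ a ∈ T with hT₀d
  set T₁ : Finset A := univ.filter fun a => τ a ∈ T with hT₁d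
  have h2c := two_c0_eq_zero hρτ hτρ hττ hτ
  have mS₀ : ∀ a ∈ S₀, cond false (τ a) (ρ a) ∈ S := fun a ha => by simpa [hS₀d] using ha
  have mS₁ : ∀ a ∈ S₁, cond true (τ a) (ρ a) ∈ S := fun a ha => by simpa [hS₁d] using ha
  have mT₀ : ∀ a ∈ T₀, cond false (τ a) (ρ a) ∈ T := fun a ha => by simpa [hT₀d] using ha
  have mT₁ : ∀ a ∈ T₁, cond true (τ a) (ρ a) ∈ T := fun a ha => by simpa [hT₁d] using ha
  have mU₀ : ∀ a ∈ U₀, cond false (τ a) (ρ a) ∈ U := fun a ha => by simpa [U₀] using ha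
  have mU₁ : ∀ a ∈ U₁, cond true (τ a) (ρ a) ∈ U := fun a ha => by simpa [U₁] using ha
  have mT₀' : ∀ a ∈ T₀, ρ a ∈ T := fun a ha => (mem_filter.1 ha).2
  have mT₁' : ∀ a ∈ T₁, τ a ∈ T := fun a ha => (mem_filter.1 ha).2
  have mS₀' : ∀ a ∈ S₀, ρ a ∈ S := fun a ha => (mem_filter.1 ha).2
  have mS₁' : ∀ a ∈ S₁, τ a ∈ S := fun a ha => (mem_filter.1 ha).2
  have mU₀' : ∀ a ∈ U₀, ρ a ∈ U := fun a ha => (mem_filter.1 ha).2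
  have mU₁' : ∀ a ∈ U₁, τ a ∈ U := fun a ha => (mem_filter.1 ha).2
  have cs := card_sumset' hρρ hττ hρ hτ h
  have hte₀ : t₀ ≠ t₀ + e₀ := fun h' => he₀ (left_eq_add.1 h')
  have hte₁ : t₁ ≠ t₁ + e₁ := fun h' => he₁ (left_eq_add.1 h')
  have cS₀ : S₀.card = 1 := by rw [hS₀, card_singleton]
  have cS₁ : S₁.card = 1 := by rw [hS₁, card_singleton]
  have cT₀ : T₀.card = 2 := by rw [hT₀, card_pair hte₀]
  have cT₁ : T₁.card = 2 := by rw [hT₁, card_pair hte₁]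
  -- the boxes at vertex `000` and their pair forms
  set B100 := (S₁ ×ˢ T₀ ×ˢ U₀).image fun p : A × A × A => p.1 + p.2.1 + p.2.2 with hB100
  set B010 := (S₀ ×ˢ T₁ ×ˢ U₀).image fun p : A × A × A => p.1 + p.2.1 + p.2.2 with hB010
  set B001 := (S₀ ×ˢ T₀ ×ˢ U₁).image fun p : A × A × A => p.1 + p.2.1 + p.2.2 with hB001
  set B000 := (S₀ ×ˢ T₀ ×ˢ U₀).image fun p : A × A × A => p.1 + p.2.1 + p.2.2 with hB000
  set B011 := (S₀ ×ˢ T₁ ×ˢ U₁).image fun p : A × A × A => p.1 + p.2.1 + p.2.2 with hB011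
  set B101 := (S₁ ×ˢ T₀ ×ˢ U₁).image fun p : A × A × A => p.1 + p.2.1 + p.2.2 with hB101
  have e100 : B100 = U₀.image (· + (s₁ + t₀)) ∪ U₀.image (· + (s₁ + t₀ + e₀)) := by
    rw [hB100, hS₁, hT₀, sumset_single_pair]
  have e010 : B010 = U₀.image (· + (s₀ + t₁)) ∪ U₀.image (· + (s₀ + t₁ + e₁)) := by
    rw [hB010, hS₀, hT₁, sumset_single_pair]
  have e001 : B001 = U₁.image (· + (s₀ + t₀)) ∪ U₁.image (· + (s₀ + t₀ + e₀)) := by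
    rw [hB001, hS₀, hT₀, sumset_single_pair]
  have e000 : B000 = U₀.image (· + (s₀ + t₀)) ∪ U₀.image (· + (s₀ + t₀ + e₀)) := by
    rw [hB000, hS₀, hT₀, sumset_single_pair]
  have e011 : B011 = U₁.image (· + (s₀ + t₁)) ∪ U₁.image (· + (s₀ + t₁ + e₁)) := by
    rw [hB011, hS₀, hT₁, sumset_single_pair]
  have c100 : B100.card = 2 * U₀.card := by rw [hB100, cs true false false mS₁ mT₀ mU₀, cS₁, cT₀]
  have c010 : B010.card = 2 * U₀.card := by rw [hB010, cs false true false mS₀ mT₁ mU₀, cS₀, cT₁]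
  have c001 : B001.card = 2 * U₁.card := by rw [hB001, cs false false true mS₀ mT₀ mU₁, cS₀, cT₀]
  have c000 : B000.card = 2 * U₀.card := by rw [hB000, cs false false false mS₀ mT₀ mU₀, cS₀, cT₀]
  have c011 : B011.card = 2 * U₁.card := by rw [hB011, cs false true true mS₀ mT₁ mU₁, cS₀, cT₁]
  -- freeness
  have fr : ∀ {X : Finset A} {a e : A}, (X.image (· + a) ∪ X.image (· + (a + e))).card = 2 * X.card →
      Disjoint X (X.image (· + e)) := by
    intro X a e hc
    have hd := disjoint_of_translates (disjoint_translates_of_card (X := X) (a := a) (b := a + e) (by omega))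
    rwa [add_sub_cancel_left] at hd
  have f₀₀ : Disjoint U₀ (U₀.image (· + e₀)) := fr (by rw [← e000, c000])
  have f₀₁ : Disjoint U₀ (U₀.image (· + e₁)) := fr (by rw [← e010, c010])
  have f₁₀ : Disjoint U₁ (U₁.image (· + e₀)) := fr (by rw [← e001, c001])
  have f₁₁ : Disjoint U₁ (U₁.image (· + e₁)) := fr (by rw [← e011, c011])
  -- disjointness at vertex `000`, plain and shifted
  have d₁ : Disjoint B100 B010 := (disjoint_sumset₁' hρρ hρτ hτρ hττ hne h) false mS₁' mT₀' mU₀ mS₀' mT₁'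
  have d₂ : Disjoint B010 B001 := (disjoint_sumset₂' hρρ hρτ hτρ hττ hne h) false mS₀ mT₁' mU₀' mS₀ mT₀' mU₁'
  have d₃ : Disjoint B001 B100 := (disjoint_sumset₃' hρρ hρτ hτρ hττ hne h) false mS₀' mT₀ mU₁' mS₁' mU₀'
  have sh₁ : Disjoint B100 (B010.image (· + c₀)) :=
    (disjoint_sumset₁_shift' hρρ hρτ hττ hne h) false mS₁' mT₀' mU₀ mS₀' mT₁'
  have sh₂ : Disjoint (B001.image (· + c₀)) B010 :=
    (disjoint_sumset₂_shift' hρρ hρτ hττ hne h) false mS₀ mT₀' mU₁' mS₀ mT₁' mU₀'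
  have sh₃ : Disjoint B100 (B001.image (· + c₀)) :=
    (disjoint_sumset₃_shift' hρρ hρτ hτρ hττ hne h) false mS₁' mT₀ mU₀' mS₀' mU₁'
  have sh₁' : Disjoint B101 (B011.image (· + c₀)) :=
    (disjoint_sumset₁_shift' hρρ hρτ hττ hne h) true mS₁' mT₀' mU₁ mS₀' mT₁'
  have hex' : 4 * U₀.card + 2 * U₁.card = Fintype.card A := hex
  have hcard : B100.card + B010.card + B001.card = Fintype.card A := by rw [c100, c010, c001]; omega
  -- periodicity of the three boxes
  have p100 : B100.image (· + c₀) = B100 :=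
    periodic_of_exact_vertex d₁ d₃.symm d₂ hcard (disjoint_image_add_comm h2c sh₁) (disjoint_image_add_comm h2c sh₃)
  have p010 : B010.image (· + c₀) = B010 :=
    periodic_of_exact_vertex d₁.symm d₂ (by exact d₃.symm) (by rw [← hcard]; ring) sh₁.symm
      (disjoint_image_add_comm h2c (by exact sh₂.symm))
  have p001 : B001.image (· + c₀) = B001 :=
    periodic_of_exact_vertex d₃ d₂.symm d₁ (by rw [← hcard]; ring) (by exact sh₃.symm) sh₂
  -- the cover `B100 ∪ B010 ∪ B001 = A`
  have hcov : B100 ∪ B010 ∪ B001 = univ := by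
    apply eq_univ_of_card
    rw [card_union_of_disjoint (disjoint_union_left.2 ⟨by exact d₃.symm, d₂⟩), card_union_of_disjoint d₁, hcard]
  refine ⟨⟨f₀₀, f₀₁, f₁₀, f₁₁⟩, ⟨?_, ?_, ?_⟩, ⟨?_, ?_, ?_⟩, ?_⟩
  · rw [← e100, ← e001]; exact d₃.symm
  · rw [← e100, ← e010]; exact d₁
  · rw [← e001, ← e010]; exact d₂.symm
  · apply periodic_of_translate_periodic (α := s₁ + t₀)
    rw [pair_translate, ← e100, p100]
  · apply periodic_of_translate_periodic (α := s₀ + t₀)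
    rw [pair_translate, ← e001, p001]
  · apply periodic_of_translate_periodic (α := s₀ + t₁)
    rw [pair_translate, ← e010, p010]
  -- the packing inclusion (F)
  · intro z hz
    set y := s₁ + t₀ + (s₀ + t₀) - (s₀ + t₁) - (s₀ + t₁) + e₀ - e₁ + c₀ with hy
    -- `z = u₁ + y + ε₁` with `t₁ + e₁ - ε₁ ∈ T₁`
    obtain ⟨u₁, hu₁, b₁, hb₁, hz⟩ : ∃ u₁ ∈ U₁, ∃ b₁ ∈ T₁, z = u₁ + y + (t₁ + e₁ - b₁) := by
      rcases mem_union.1 hz with hz | hz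
      · obtain ⟨u, hu, rfl⟩ := mem_image.1 hz
        exact ⟨u, hu, t₁ + e₁, by rw [hT₁]; exact mem_insert_of_mem (mem_singleton_self _), by abel⟩
      · obtain ⟨u, hu, rfl⟩ := mem_image.1 hz
        exact ⟨u, hu, t₁, by rw [hT₁]; exact mem_insert_self _ _, by abel⟩
    have hflipT₀ : ∀ b ∈ T₀, t₀ + t₀ + e₀ - b ∈ T₀ := by
      intro b hb
      rw [hT₀, mem_insert, mem_singleton] at hb ⊢
      rcases hb with rfl | rfl
      · right; abel
      · left; abel
    have hz' : z + (s₀ + t₁) ∈ B100 ∪ B010 ∪ B001 := by rw [hcov]; exact mem_univ _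
    rw [hz] at hz'
    rcases mem_union.1 hz' with hz' | hz'
    · rcases mem_union.1 hz' with hz' | hz'
      · -- in `B100`: contradicts `sh₂`
        exfalso
        rw [hB100, mem_sumset₃] at hz'
        obtain ⟨a, ha, b, hb, u₀, hu₀, heq⟩ := hz'
        rw [hS₁, mem_singleton] at ha
        rw [ha] at heq
        have m1 : s₀ + (t₀ + t₀ + e₀ - b) + u₁ + c₀ ∈ B001.image (· + c₀) := by
          refine mem_image_of_mem _ ?_
          rw [hB001, mem_sumset₃]
          exact ⟨s₀, by rw [hS₀]; exact mem_singleton_self _, _, hflipT₀ b hb, u₁, hu₁, rfl⟩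
        have m2 : s₀ + b₁ + u₀ ∈ B010 := by
          rw [hB010, mem_sumset₃]
          exact ⟨s₀, by rw [hS₀]; exact mem_singleton_self _, b₁, hb₁, u₀, hu₀, rfl⟩
        refine disjoint_left.1 sh₂ m1 ?_
        have e' : u₀ = u₁ + y + (t₁ + e₁ - b₁) + (s₀ + t₁) - s₁ - b := by rw [← heq]; abel
        have : s₀ + (t₀ + t₀ + e₀ - b) + u₁ + c₀ = s₀ + b₁ + u₀ := by rw [e', hy]; abel
        rw [this]; exact m2
      · -- in `B010`: the conclusion
        rw [hB010, mem_sumset₃] at hz'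
        obtain ⟨a, ha, b, hb, u₀, hu₀, heq⟩ := hz'
        rw [hS₀, mem_singleton] at ha
        rw [ha] at heq
        rw [hT₁, mem_insert, mem_singleton] at hb
        rw [hz]
        rcases hb with hb | hb <;> rw [hb] at heq
        · have : u₀ = u₁ + y + (t₁ + e₁ - b₁) :=
            add_right_cancel (b := s₀ + t₁) (by rw [← heq]; abel)
          exact mem_union_left _ (by rw [← this]; exact hu₀)
        · have : u₀ + e₁ = u₁ + y + (t₁ + e₁ - b₁) :=
            add_right_cancel (b := s₀ + t₁) (by rw [← heq]; abel)
          exact mem_union_right _ (mem_image.2 ⟨u₀, hu₀, this⟩)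
    · -- in `B001`: contradicts `sh₁'`
      exfalso
      rw [hB001, mem_sumset₃] at hz'
      obtain ⟨a, ha, b, hb, u₁', hu₁', heq⟩ := hz'
      rw [hS₀, mem_singleton] at ha
      rw [ha] at heq
      have m1 : s₁ + (t₀ + t₀ + e₀ - b) + u₁ ∈ B101 := by
        rw [hB101, mem_sumset₃]
        exact ⟨s₁, by rw [hS₁]; exact mem_singleton_self _, _, hflipT₀ b hb, u₁, hu₁, rfl⟩
      have m2 : s₀ + b₁ + u₁' + c₀ ∈ B011.image (· + c₀) := by
        refine mem_image_of_mem _ ?_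
        rw [hB011, mem_sumset₃]
        exact ⟨s₀, by rw [hS₀]; exact mem_singleton_self _, b₁, hb₁, u₁', hu₁', rfl⟩
      refine disjoint_left.1 sh₁' m1 ?_
      have e' : u₁' = u₁ + y + (t₁ + e₁ - b₁) + (s₀ + t₁) - s₀ - b := by rw [← heq]; abel
      have : s₁ + (t₀ + t₀ + e₀ - b) + u₁ = s₀ + b₁ + u₁' + c₀ := by
        rw [show s₀ + b₁ + u₁' + c₀ = s₁ + (t₀ + t₀ + e₀ - b) + u₁ + (c₀ + c₀) by rw [e', hy]; abel, h2c,
          add_zero]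
      rw [this]; exact m2

/-- **The exact case.**  Dicyclic type, `π : A →+ B` onto with kernel `{0,c₀}`, `B` a `2`-group, `A/⟨c₀⟩ ↠ 𝔽₂³` via
`ψ₁, ψ₂, ψ₃` killing `c₀`: a TPP triple with `|S₀| = |S₁| = 1`, `|T₀| = |T₁| = 2`, `|U₀| = |U₁| + 2` and
`4|U₀| + 2|U₁| = |A|` does not exist (the data of `n1_vertex_data` for the triple and its `T·τ0`-translate feed
`n1_four_cosets`, contradicting `psi_not_onto_of_four_cosets`). [folklore] -/
theorem n1_false_of_exact
    (hρρ : ∀ a b, ρ a * ρ b = ρ (a + b)) (hρτ : ∀ a b, ρ a * τ b = τ (b - a))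
    (hτρ : ∀ a b, τ a * ρ b = τ (a + b)) (hττ : ∀ a b, τ a * τ b = ρ (c₀ + b - a)) (hc₀ : c₀ ≠ 0)
    (hρ : Function.Injective ρ) (hτ : Function.Injective τ) (hne : ∀ a b, ρ a ≠ τ b)
    (ψ₁ ψ₂ ψ₃ : A →+ ZMod 2) (hψc : ψ₁ c₀ = 0 ∧ ψ₂ c₀ = 0 ∧ ψ₃ c₀ = 0)
    (hψ : ∀ v : ZMod 2 × ZMod 2 × ZMod 2, ∃ x, (ψ₁ x, ψ₂ x, ψ₃ x) = v)
    (π : A →+ B) (hπ : Function.Surjective π) (hker : ∀ a : A, π a = 0 ↔ a = 0 ∨ a = c₀)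
    {m : ℕ} (hB : ∀ b : B, (2 ^ m) • b = 0)
    {S T U : Finset G} (h : TripleProductProperty S T U)
    (hs₀ : (univ.filter fun a : A => ρ a ∈ S).card = 1) (hs₁ : (univ.filter fun a : A => τ a ∈ S).card = 1)
    (ht₀ : (univ.filter fun a : A => ρ a ∈ T).card = 2) (ht₁ : (univ.filter fun a : A => τ a ∈ T).card = 2)
    (hcard : (univ.filter fun a : A => ρ a ∈ U).card = (univ.filter fun a : A => τ a ∈ U).card + 2)
    (hex : 4 * (univ.filter fun a : A => ρ a ∈ U).card + 2 * (univ.filter fun a : A => τ a ∈ U).card =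
      Fintype.card A) : False := by
  -- the elements of the small parts
  obtain ⟨s₀, hS₀⟩ := card_eq_one.1 hs₀
  obtain ⟨s₁, hS₁⟩ := card_eq_one.1 hs₁
  obtain ⟨t₀, t₀', htt₀, hT₀'⟩ := card_eq_two.1 ht₀
  obtain ⟨t₁, t₁', htt₁, hT₁'⟩ := card_eq_two.1 ht₁
  have hT₀ : (univ.filter fun a : A => ρ a ∈ T) = {t₀, t₀ + (t₀' - t₀)} := by rw [add_sub_cancel]; exact hT₀'
  have hT₁ : (univ.filter fun a : A => τ a ∈ T) = {t₁, t₁ + (t₁' - t₁)} := by rw [add_sub_cancel]; exact hT₁'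
  have he₀ : t₀' - t₀ ≠ 0 := sub_ne_zero.2 htt₀.symm
  have he₁ : t₁' - t₁ ≠ 0 := sub_ne_zero.2 htt₁.symm
  set e₀ := t₀' - t₀ with he₀d
  set e₁ := t₁' - t₁ with he₁d
  -- data of the triple itself (vertex `000`)
  obtain ⟨⟨f₀₀, f₀₁, f₁₀, f₁₁⟩, ⟨h12, h13, h23⟩, ⟨p₀₀, p₀₁, p₁₀⟩, hsub⟩ :=
    n1_vertex_data hρρ hρτ hτρ hττ hρ hτ hne h hS₀ hS₁ hT₀ hT₁ he₀ he₁ hex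
  -- the `T·τ0`-translate (vertex `010`)
  have er : (Equiv.mulRight (1 : G)).toEmbedding = Function.Embedding.refl G := by ext x; simp
  have h' : TripleProductProperty S (T.map (Equiv.mulRight (τ 0)).toEmbedding) U := by
    have := h.map_mulRight 1 (τ 0) 1; simpa only [er, Finset.map_refl] using this
  have hT'₀ : (univ.filter fun a : A => ρ a ∈ T.map (Equiv.mulRight (τ 0)).toEmbedding) =
      {-c₀ - (t₁ + e₁), -c₀ - (t₁ + e₁) + e₁} := by
    rw [rho_part_mulRight_tau hρρ hρτ hττ T, hT₁, image_insert, image_singleton,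
      show -c₀ - t₁ = -c₀ - (t₁ + e₁) + e₁ by abel, pair_comm]
  have hT'₁ : (univ.filter fun a : A => τ a ∈ T.map (Equiv.mulRight (τ 0)).toEmbedding) =
      {-(t₀ + e₀), -(t₀ + e₀) + e₀} := by
    rw [tau_part_mulRight_tau hρρ hττ T, hT₀, image_insert, image_singleton,
      show -t₀ = -(t₀ + e₀) + e₀ by abel, pair_comm]
  obtain ⟨-, ⟨k12, k13, k23⟩, ⟨-, p₁₁, -⟩, -⟩ :=
    n1_vertex_data hρρ hρτ hτρ hττ hρ hτ hne h' hS₀ hS₁ hT'₀ hT'₁ he₁ he₀ hex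
  -- the four cosets
  obtain ⟨g, z, hcov⟩ := n1_four_cosets π hπ hker hc₀ hB f₀₀ f₀₁ f₁₀ f₁₁ hcard hex.symm h12 h13 h23 k12 k13 k23
    (by abel) (by abel) rfl p₀₀ p₀₁ p₁₀ p₁₁ hsub
  exact psi_not_onto_of_four_cosets ψ₁ ψ₂ ψ₃ hψc hcov hψ

/-- **No N1-class dicyclic-law triple when `A/⟨c₀⟩` is a `2`-group mapping onto `𝔽₂³`.**  Dicyclic type (`c₀ ≠ 0`),
three homomorphisms `A →+ ZMod 2` killing `c₀` jointly onto `𝔽₂³`, `π : A →+ B` onto with kernel `{0, c₀}`, `2^m · B = 0`.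
Then no TPP triple with `|S₀| = |S₁| = 1`, `|T₀| = |T₁| = 2` and `|U₀| ≠ |U₁|` attains `3|S||T||U| + 16 = 8|A|`.
(The law gives `|A| = 3|U| + 2`, the vertices `000`/`111` and `8 ∣ |A|` give `|U₀| = |U₁| ± 2`; after a
`τ0`-translation of `U` the exact case `n1_false_of_exact` applies.) [folklore] -/
theorem no_n1_dicyclic_law
    (hρρ : ∀ a b, ρ a * ρ b = ρ (a + b)) (hρτ : ∀ a b, ρ a * τ b = τ (b - a))
    (hτρ : ∀ a b, τ a * ρ b = τ (a + b)) (hττ : ∀ a b, τ a * τ b = ρ (c₀ + b - a)) (hc₀ : c₀ ≠ 0)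
    (hρ : Function.Injective ρ) (hτ : Function.Injective τ) (hne : ∀ a b, ρ a ≠ τ b)
    (hsurj : ∀ g, (∃ a, ρ a = g) ∨ (∃ a, τ a = g))
    (ψ₁ ψ₂ ψ₃ : A →+ ZMod 2) (hψc : ψ₁ c₀ = 0 ∧ ψ₂ c₀ = 0 ∧ ψ₃ c₀ = 0)
    (hψ : ∀ v : ZMod 2 × ZMod 2 × ZMod 2, ∃ x, (ψ₁ x, ψ₂ x, ψ₃ x) = v)
    (π : A →+ B) (hπ : Function.Surjective π) (hker : ∀ a : A, π a = 0 ↔ a = 0 ∨ a = c₀)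
    {m : ℕ} (hB : ∀ b : B, (2 ^ m) • b = 0)
    {S T U : Finset G} (h : TripleProductProperty S T U)
    (hs₀ : (univ.filter fun a : A => ρ a ∈ S).card = 1) (hs₁ : (univ.filter fun a : A => τ a ∈ S).card = 1)
    (ht₀ : (univ.filter fun a : A => ρ a ∈ T).card = 2) (ht₁ : (univ.filter fun a : A => τ a ∈ T).card = 2)
    (hU : (univ.filter fun a : A => ρ a ∈ U).card ≠ (univ.filter fun a : A => τ a ∈ U).card) :
    3 * (S.card * T.card * U.card) + 16 ≠ 8 * Fintype.card A := by
  intro hV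
  have cS : S.card = 2 := by rw [card_eq_parts' hρ hτ hne hsurj S, hs₀, hs₁]
  have cT : T.card = 4 := by rw [card_eq_parts' hρ hτ hne hsurj T, ht₀, ht₁]
  have cU := card_eq_parts' hρ hτ hne hsurj U
  have h8 : 8 ∣ Fintype.card A := eight_dvd_card_of_onto ψ₁ ψ₂ ψ₃ hψ
  obtain ⟨h000, h111, -⟩ := vertex_counting' hρρ hρτ hτρ hττ hρ hτ hne h
  rw [hs₀, hs₁, ht₀, ht₁] at h000 h111
  rw [cS, cT, cU] at hV
  set u₀ := (univ.filter fun a : A => ρ a ∈ U).card with hu₀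
  set u₁ := (univ.filter fun a : A => τ a ∈ U).card with hu₁
  obtain ⟨q, hq⟩ := h8
  by_cases hcase : u₀ = u₁ + 2
  · exact n1_false_of_exact hρρ hρτ hτρ hττ hc₀ hρ hτ hne ψ₁ ψ₂ ψ₃ hψc hψ π hπ hker hB h hs₀ hs₁ ht₀ ht₁ hcase
      (by omega)
  · have hcase' : u₁ = u₀ + 2 := by omega
    -- translate `U` by `τ0`: the parts swap
    have er : (Equiv.mulRight (1 : G)).toEmbedding = Function.Embedding.refl G := by ext x; simp
    have h' : TripleProductProperty S T (U.map (Equiv.mulRight (τ 0)).toEmbedding) := by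
      have := h.map_mulRight 1 1 (τ 0); simpa only [er, Finset.map_refl] using this
    have cU'₀ := card_rho_part_mulRight_tau hρρ hρτ hττ (A := A) U
    have cU'₁ := card_tau_part_mulRight_tau hρρ hττ (A := A) U
    exact n1_false_of_exact hρρ hρτ hτρ hττ hc₀ hρ hτ hne ψ₁ ψ₂ ψ₃ hψc hψ π hπ hker hB h' hs₀ hs₁ ht₀ ht₁
      (by rw [cU'₀, cU'₁]; omega) (by rw [cU'₀, cU'₁]; omega)

end N1

end Summit.MatrixMultiplication.OmegaCensus
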